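import Summits.FinalStateConjecture.FinalStateConjecture.Theorems.ClusterCompletenessOmegaLimitMultiKerrHolesJointFlat
import Summits.FinalStateConjecture.FinalStateConjecture.Theorems.ClusterCompletenessOmegaLimitMultiKerrSequential
import HarnessLib

/-!
# Route ClusterCompleteness · crux `OmegaLimitMultiKerr` — the recur-disjunct `Recurs k 𝒟` itself
# feeds the ω-limit dictionary: joint flat ω-limits for the crux's own configuration, if it is tame

Structure lemma for the crux stmt-FinalStateConjecture-14664 (`ClusterCompleteness.OmegaLimitMultiKerr`,
rank 9), line `Sketch`, lead gen 3. Composition BY NAME of the sequential form of the recur-disjunct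
(`recurs_iff_exists_seq`) with the crux-level dictionary theorem
(`exists_strictMono_forall_hole_omegaLimit_flat`): a development that RECURS at order `k` carries
`N` smooth hole charts on boosted Kerr backgrounds and one sequence of chart times `T n → ∞` along
which every hole recurs at every radius; IF these charts are tame at order `k + 1` (finite
`C^{k+1}` size of each deviation on every truncated late region — the content of the generic stub of
the recommended re-line, NOT of `Recurs`), THEN along one common subsequence every hole has a `Cᵏ`
ω-limit of its translated deviation, flat to order `k` on its time-zero slab. (Hale 1980, Ch. I, §8.)
-/

-- every `Summit.FinalStateConjecture.FinalStateConjecture.…` name repeats the summit = sub-problem segment (D-0017 layout)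
set_option linter.dupNamespace false

noncomputable section

open scoped Manifold ContDiff Topology ENNReal
open Set Filter TopologicalSpace

namespace Summit.FinalStateConjecture.FinalStateConjecture.Theorems.ClusterCompleteness

open Literature.Geometry.Lorentzian

/-- **`Recurs k 𝒟` feeds the dictionary.** If the maximal development `𝒟` recurs at order `k`, then
there are hole data — sub-extremal labels `(Mᵢ, aᵢ)`, motions `moᵢ`, a late time `τ₀`, SMOOTH hole
charts `Ψᵢ` on `boostedKerrBackground (mo i).1 (mo i).2 (M i) (a i)` — and chart times `T n → ∞`
along which every hole recurs at every radius (`truncDeviationCk … (Ψ i) k R' (T n) → 0`), such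
that WHENEVER the charts are tame at order `k + 1` after `τ₀`, one common subsequence gives every
hole a `Cᵏ` ω-limit of its `Λᵢ∂₀`-translated deviation on compacts of its exterior, all of whose
derivatives of order `≤ k` vanish on `{t*ᵢ = 0}` (Hale 1980, Ch. I, §8). [cite: Hale1980, Ch. I §8] -/
theorem exists_holes_of_recurs_forall_tame_omegaLimit_flat :
    ∀ {X : Type} [TopologicalSpace X] [ChartedSpace E3 X] [IsManifold (𝓡 3) ∞ X]
      [ConnectedSpace X] {D : InitialDataSet (𝓡 3) X} (k : ℕ) (𝒟 : VacuumCauchyDevelopment D),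
      Recurs k 𝒟 →
      ∃ (N : ℕ) (M a : Fin N → ℝ) (mo : Fin N → lorentzGroup × E4) (τ₀ : ℝ)
        (Ψ : ∀ i, (boostedKerrBackground (mo i).1 (mo i).2 (M i) (a i)).domain → 𝒟.carrier)
        (T : ℕ → ℝ),
        (∀ i, Kerr.IsSubextremal (M i) (a i)) ∧ (∀ i, ContMDiff 𝓘(ℝ, E4) (𝓡 4) ∞ (Ψ i)) ∧
        Tendsto T atTop atTop ∧
        (∀ i (R' : ℝ), Tendsto (fun n ↦ 𝒟.toSpacetime.truncDeviationCk
          (boostedKerrBackground (mo i).1 (mo i).2 (M i) (a i)) (Ψ i) k R' (T n)) atTop (𝓝 0)) ∧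
        ((∀ i (R : ℝ), supCkENorm (Subtype.val ''
            (boostedKerrBackground (mo i).1 (mo i).2 (M i) (a i)).truncLateRegion τ₀ R) (k + 1)
            (𝒟.toSpacetime.deviationExtend (boostedKerrBackground (mo i).1 (mo i).2 (M i) (a i))
              (Ψ i)) ≠ ⊤) →
          ∃ φ : ℕ → ℕ, StrictMono φ ∧ ∀ i, ∃ g : E4 → E4 →L[ℝ] E4 →L[ℝ] ℝ,
            ContDiffOn ℝ k g (boostedKerrExterior (mo i).1 (mo i).2 (M i) (a i) : Set E4) ∧
            (∀ K ⊆ (boostedKerrExterior (mo i).1 (mo i).2 (M i) (a i) : Set E4), IsCompact K →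
              Tendsto (fun n ↦ supCkENorm K k (fun x ↦
                𝒟.toSpacetime.deviationExtend (boostedKerrBackground (mo i).1 (mo i).2 (M i) (a i))
                  (Ψ i) (x + T (φ n) • ((mo i).1 : E4 ≃L[ℝ] E4)
                    (EuclideanSpace.single (0 : Fin 4) (1 : ℝ))) - g x)) atTop (𝓝 0)) ∧
            ∀ x ∈ Subtype.val ''
              (boostedKerrBackground (mo i).1 (mo i).2 (M i) (a i)).timeSlab 0,
              ∀ m, m ≤ k → iteratedFDeriv ℝ m g x = 0) := by
  intro X _ _ _ _ D k 𝒟 hrec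
  obtain ⟨_, N, M, a, mo, τ₀, Ψ, _, _, _, _, hsub, hcharts, -, -, -, -, -, -, -, -, T, hT, -,
    hrecT⟩ := (recurs_iff_exists_seq k 𝒟).1 hrec
  refine ⟨N, M, a, mo, τ₀, Ψ, T, hsub, fun i ↦ (hcharts i).contMDiff, hT, hrecT, fun htame ↦ ?_⟩
  exact exists_strictMono_forall_hole_omegaLimit_flat 𝒟.toSpacetime N mo M a Ψ
    (fun i ↦ (hcharts i).contMDiff) htame hT hrecT

end Summit.FinalStateConjecture.FinalStateConjecture.Theorems.ClusterCompleteness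

end
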